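import Summits.QuantumFields.YangMills.Theorems.BalabanUVNodesN11AFibreDominationOnJointSupport
import Summits.QuantumFields.YangMills.Theorems.BalabanUVNodesN11TwoScaleLocalityJointSupport
import Summits.QuantumFields.YangMills.Theorems.BalabanUVNodesN11NoExpansionStepSpecificationOfTermRows

/-!
# DAG node N11 — THE SPECIFICATION OF THE NO-EXPANSION 𝐓-STEP FOR A GENERIC STAGE-13 PARAMETER WITH [I]'s POSITIVITY OF `𝒬_j` ASKED ONLY ON THE JOINT
# SUPPORT OF THE INTEGRAND's CERTIFICATES (the step's own `χ_k(Ω_k)` and every `ζ_i(Ω^c_{i+1})`, `j ≤ i < k`) — resp. only where every scale present is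
# regular on its reading region, given def-T's `RegOn`: the joint-support editions of this base's g0 `…N11NoExpansionStepSpecificationOfCoercive`

HEADER — WORK-UNIT METADATA.  Cell `pub-ymgap`, YM-PLAN Track A (HUMAN RULING D-0062 ∕ D-0149), WIDTH SEAT `pub-ymgap-dag-n11-w4` (g2) on NODE n11 [B14]; route
`BalabanUVNodes` rev 25, item K1⁷ `StabilityBAtRecordR13SepCoPH` = stmt-QuantumFields-20542 (helper, `--kind proof --supports 20542 --as helper`, count-neutral).
[III] = [Balaban1988Convergent], [I] = [Balaban1987RG1], [IV] = [Balaban1989LargeFieldI].  Over this seat's `…N11AFibreDominationOnJointSupport` (★★★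
`integrable_front_mul_oldBranch_of_coercive_on_joint_support`), dag-n11-d's B3 §1 `clause_succ_CoPH_of_Omega_empty_of_pinChi_of_provisos_of_clause_of_graph`
(binder `hI`: integrability of the NEW integrand `χ_k(init s′)(U₀)·w_k(s′)(U₀,Ū₀)·𝐓_k(init s′,S)[e^{A_k(init s′)}](U₀)` — `newIntegrand_eq_of_pinChi`), p583082's proof pattern
(`sLaw₁₃CoPH_iff_exists_local`), p584440 (`measurable_sect2Operand_of_termRows`, `exists_bound_sect2Operand_of_termBounds`), p585753 (`measurable_UbgOfRecord₁₃CoP`).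

WHY THIS FILE.  p583082 ∕ g0 discharge B3's binder through §2 of B3, i.e. through PLAIN integrability of the old branch — forgetting that the new integrand carries
the step's own front factor `χ_k(init s′)·w_k`.  Re-entering at B3 §1 keeps the front factor, and this seat's joint-support theorem then asks [I]'s positivity of
`𝒬_j` exactly where the integrand is alive: `χ_k(init s′)(U₀) ≠ 0` (the step's small-field certificate of `U₀` on `Ω_k`, (2.17)–(2.18) p.257) and, for every
`i ∈ [j,k)`, `ζ_i((Ω_{i+1})ᶜ) ≠ 0` at an `A_i`-fibre-mate (the certificates of the retained variables `V_i` on `Γ_i`, p.256; locality of `ζ0` is the core proviso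
`zhLocal`).  The scales `< j` are not yet integrated where `w_j` is read (11a reads them at the base configuration `1`, a regular field), so NO certificate of the
integrand is left out.

WHAT THIS FILE PROVES (0 `sorry`, 0 `def`; 3 thm).  ★★★ `exists_local_witness_clause_succ_of_sLaw₁₃CoPH_of_coercive_on_joint_support` (p583082's rows with the
per-branch domination row REPLACED by joint-support coercivity; operand rows kept); ★★★ `…_of_coercive_on_joint_support_of_termRows` (def-T's six term rows instead
of the operand rows — every row on a primitive of record); ★★★ `…_of_regOn_of_coercive_on_joint_reading_of_termRows` (the print-shaped all-primitive edition: def-T's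
`RegOn Γr` + coercivity only where `χ_k(init s′)(U₀) ≠ 0` and EVERY scale `i ∈ [j,k)` is `(cR·ε_i)`-regular on `Γr i (Ω_{i+1})ᶜ` + term rows).

HONEST FRAMING.  Helper lane of K1⁷; composition of accepted kernel bookkeeping; nothing of Bałaban's estimates is asserted; no law of record is edited or posited;
all rows are properties of the DATA (K0b's VALUE of `θ.Zh`; def-T's term values); sequences with `Ω_{k+1}(s′) ≠ ∅` are [III] §3 + Thm 2 proper, not this lane's.
N11 NOT discharged; K1⁷ NOT closed; counts unmoved (typed 28∕28 · discharged 5∕27).  One finite four-torus programme at fixed `ε = L^{−K}`; R4 closes only the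
conditional finite-𝕋⁴ rung `BalabanLadder.UV` — NOT ℝ⁴, NOT OS, NOT a mass gap, NOT Clay.  No `sorry`, `axiom`, `instance`, `notation`.
Sources (SHAPE only): [III] Theorem p.245, (2.10) p.256, (2.17)–(2.18) p.257, (2.20)–(2.27) pp.258–259, (2.31) p.260, (2.41) p.261, (3.16)–(3.21) pp.268–269,
(3.23)–(3.25) p.270, Thm 1 p.262; [IV] (0.2)–(0.3) p.176; [I] (2.11) p.267 (shape of the coercivity row).
-/

noncomputable section

open MeasureTheory
open scoped BigOperators ENNReal NNReal Matrix.Norms.L2Operator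

namespace Summit.QuantumFields.YangMills.Theorems.BalabanUVNodesN11NoExpansionStepSpecificationOfCoerciveOnJointSupport

open Literature.MathematicalPhysics.QuantumFieldTheory.Balaban1983to89 T4Continuum T4NestedCovariance T4AdjointCovariance Node00 Node00.Tk DagBinding
open B15DeterminingSets
open B8Eq17ClassAkV1 (plaqsOf)
open B10Eq42TorusConstraint (bondsIn)
open BalabanUVNodesN11FluctTruncationDefs
open BalabanUVNodesN11FluctTruncation (sLaw₁₃CoPH_iff_exists_local)
open BalabanUVNodesN11NoExpansionOldBranchGraph (clause_succ_CoPH_of_Omega_empty_of_pinChi_of_provisos_of_clause_of_graph)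
open BalabanUVNodesN11NoExpansionGeneralStepCoPHOldBranch (newIntegrand_eq_of_pinChi measurable_chiSeqOfRecord_init)
open BalabanUVNodesN11TwoScaleLocalityJointSupport (integrable_front_mul_oldBranch_of_coercive_on_joint_support₂)
open BalabanUVNodesN11OperandRowsOfTermRows (measurable_sect2Operand_of_termRows exists_bound_sect2Operand_of_termBounds)
open BalabanUVNodesN11BackgroundCoPMeasurable (measurable_UbgOfRecord₁₃CoP)
open BalabanUVNodesN11AFibreDominationOnJointSupport (integrable_front_mul_oldBranch_of_coercive_on_joint_support)

variable {F : T4Family} {N : ℕ} [NeZero N]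

variable (θ : Stage13HParams F N) (p : B12.RunParams)

/-- **★★★ THE NO-EXPANSION 𝐓-STEP SPECIFICATION AT A GENERIC `θ`, COERCIVITY ON THE JOINT SUPPORT**: dag-n11-d's ★★★
`exists_local_witness_clause_succ_of_sLaw₁₃CoPH_of_rows` with the per-branch A-fibre domination row REPLACED by: for each generation `j < k` one `c_j > 0` with
`c_j·Σ_{b∈sA_j} ‖A_j(b)‖² ≤ quad_j(Λ_{j+1}(init s′))(ω′)` at every configuration `ω′` whose level-`k` gauge component passes the step's certificate
`χ_k(init s′) ≠ 0` and which has, for every `i ∈ [j,k)`, an `A_i`-fibre-mate with `ζ0_i((Ω_{i+1}(init s′))ᶜ) ≠ 0` ([I]'s positivity of `𝒬_j`, displayed, exactly on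
the support of the integrand).  Row order: run∕numerics; per no-expansion history `s′`: (P), (V), `hq`, `hqloc`, measurability of `ζ0`∕`quad`, JOINT-SUPPORT
COERCIVITY, operand rows.  (Locality of `ζ0` is the core proviso `zhLocal`; the proof re-enters B3 at its §1 binder — the NEW integrand with its front factor.)
[cite: Balaban1988Convergent, Theorem p.245, Thm 1 p.262, (3.24)–(3.25) p.270, (2.17)–(2.18) p.257, (2.20)–(2.23) p.258, (2.10) p.256, (3.16)–(3.21) pp.268–269; Balaban1987RG1, (2.11) p.267 (shape of the row)] -/
theorem exists_local_witness_clause_succ_of_sLaw₁₃CoPH_of_coercive_on_joint_support (h : θ.Provisos₁₃CoPH F N) (hU : θ.ZhUnity F N) {k : ℕ} (hk : k < p.K)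
    (hM : 1 ≤ θ.τ9.M) (hS : SLaw₁₃CoPH F N θ p k) :
    ∃ (t : SeqOfRecord F θ.ν θ.τ9.M (gOfRecord₁₃ F N θ.toStage13Params p) p.K k → Sect2.TermValues (F.P p.K) (MatA N) (FluctV N) θ.τ9.M)
      (Ek : SeqOfRecord F θ.ν θ.τ9.M (gOfRecord₁₃ F N θ.toStage13Params p) p.K k → ℝ),
      HasSect2FormAtZS F N (FluctV N) p.K (settingOfRecord₁₃ F N θ.toStage13Params p) k (θ.rzAt p) (WtOfRecord₁₃H F N θ p)
          (UbgOfRecord₁₃CoP F N θ.toStage13Params p k)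
          (fun s₀ t₀ => Sect2.LawsRT (sect2TowerOfRecord F N (FluctV N) p.K (settingOfRecord₁₃ F N θ.toStage13Params p) (θ.rzAt p s₀) s₀ t₀)
            (settingOfRecord₁₃ F N θ.toStage13Params p).lf k)
          (slotsOfRecord F N θ.ν θ.τ9 (EOfRecord₁₃ F N θ.toStage13Params) (wOfRecord₉ F N θ.toStage9Params) θ.ppSel p
            (gOfRecord₁₃ F N θ.toStage13Params p) k) t Ek ∧
      (∀ s₀, IsFluctLocal k (t s₀)) ∧
      ∀ (s : SeqOfRecord F θ.ν θ.τ9.M (gOfRecord₁₃ F N θ.toStage13Params p) p.K (k + 1)), s.Ω (k + 1) = ∅ →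
        -- (P) prefix agreement below `k`
        (∀ j, j < k → (θ.zhAt p s).ζ0 j = (θ.zhAt p s.init).ζ0 j ∧ (θ.zhAt p s).quad j = (θ.zhAt p s.init).quad j) →
        -- (V) the generation-`k` pin with the old front factor
        (∀ (V' : GaugeField (F.P p.K) (k + 1) (SU N)) (U₀ : GaugeField (F.P p.K) k (SU N)),
          (θ.zhAt p s).ζ0 k Set.univ (pairCfgAt (V := FluctV N) k V' U₀) =
            chiSeqOfRecord F N θ.ν θ.τ9.M (gOfRecord₁₃ F N θ.toStage13Params p) p.K k s.init U₀ *
              wOfRecord₉ F N θ.toStage9Params p (gOfRecord₁₃ F N θ.toStage13Params p) k s U₀ ((avOfRecord F N p.K k).avg U₀)) →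
        -- `quad_k(∅) = 0` on the two-scale configurations
        (∀ (V' : GaugeField (F.P p.K) (k + 1) (SU N)) (U₀ : GaugeField (F.P p.K) k (SU N)), (θ.zhAt p s).quad k ∅ (pairCfgAt (V := FluctV N) k V' U₀) = 0) →
        -- `k`-locality of `quad_j(Λ_{j+1})`, `j < k`
        (∀ j, j < k → ∀ ω ω' : MultiCfg (F.P p.K) (SU N) (FluctV N), (∀ i, i ≤ k → ω i = ω' i) →
          (θ.zhAt p s).quad j (s.init.Λ (j + 1)) ω = (θ.zhAt p s).quad j (s.init.Λ (j + 1)) ω') →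
        -- measurability of the residual serving `s′`
        (∀ j (Y : Set (Site (F.P p.K) 0)), Measurable ((θ.zhAt p s).ζ0 j Y)) →
        (∀ j (Λ' : Set (Site (F.P p.K) 0)), Measurable ((θ.zhAt p s).quad j Λ')) →
        -- COERCIVITY of `quad_j(Λ_{j+1})` ON THE JOINT SUPPORT: the step's own certificate `χ_k(init s′)(U₀) ≠ 0` AND, for every `i ∈ [j,k)`, an
        -- `A_i`-fibre-mate with `ζ0_i((Ω_{i+1})ᶜ) ≠ 0` ([I]'s positivity of `𝒬_j` exactly where every certificate of the integrand is alive)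
        (∀ j : ℕ, j < k → ∃ c : ℝ, 0 < c ∧ ∀ ω' : MultiCfg (F.P p.K) (SU N) (FluctV N),
          chiSeqOfRecord F N θ.ν θ.τ9.M (gOfRecord₁₃ F N θ.toStage13Params p) p.K k s.init (ω' k).1 ≠ 0 →
          (∀ i, j ≤ i → i < k → ∃ cf : JCfg (F.P p.K) i (SU N) (FluctV N), cf.1 = (ω' i).1 ∧
            (∀ b, b ∉ bondsIn i ((s.init.Λ (i + 1))ᶜ ∩ s.init.Ω (i + 1)) → cf.2 b = (ω' i).2 b) ∧
            (θ.zhAt p s).ζ0 i (s.init.Ω (i + 1))ᶜ (Function.update ω' i cf) ≠ 0) →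
          c * ∑ b ∈ (Set.toFinite (bondsIn j ((s.init.Λ (j + 1))ᶜ ∩ s.init.Ω (j + 1)))).toFinset, ‖(ω' j).2 b‖ ^ 2 ≤
            (θ.zhAt p s).quad j (s.init.Λ (j + 1)) ω') →
        -- the operand rows of the witness (def-T ∕ def-R)
        (∀ S ∈ admSOfRecord F θ.ν θ.τ9.M (gOfRecord₁₃ F N θ.toStage13Params p) p.K k s.init,
          Measurable (fun ω : MultiCfg (F.P p.K) (SU N) (FluctV N) =>
            sect2Operand F N (FluctV N) p.K (settingOfRecord₁₃ F N θ.toStage13Params p) (θ.rzAt p s.init) s.init (t s.init) (Ek s.init)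
                (UbgOfRecord₁₃CoP F N θ.toStage13Params p k s.init) (S, fun j => (ω j).2) (fun j => (ω j).1)) ∧
          ∃ CΦ : ℝ, ∀ a U, sect2Operand F N (FluctV N) p.K (settingOfRecord₁₃ F N θ.toStage13Params p) (θ.rzAt p s.init) s.init (t s.init) (Ek s.init)
                (UbgOfRecord₁₃CoP F N θ.toStage13Params p k s.init) a U ≤ CΦ) →
        (slotsTOfRecord F N θ.ν θ.τ9 (EOfRecord₁₃ F N θ.toStage13Params) (wOfRecord₉ F N θ.toStage9Params) θ.ppSel p
            (gOfRecord₁₃ F N θ.toStage13Params p) (k + 1) s = 0 ∨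
          ∀ᵐ V' ∂fieldMeasure (F.P p.K) (k + 1) (SU N),
            chiSeqOfRecord F N θ.ν θ.τ9.M (gOfRecord₁₃ F N θ.toStage13Params p) p.K (k + 1) s V' ≠ 0 →
              slotsTOfRecord F N θ.ν θ.τ9 (EOfRecord₁₃ F N θ.toStage13Params) (wOfRecord₉ F N θ.toStage9Params) θ.ppSel p
                  (gOfRecord₁₃ F N θ.toStage13Params p) (k + 1) s V' =
                sect2Slot F N (FluctV N) p.K (settingOfRecord₁₃ F N θ.toStage13Params p) (θ.rzAt p s) (WtOfRecord₁₃H F N θ p s) s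
                  (t s.init) (Ek s.init) (UbgOfRecord₁₃CoP F N θ.toStage13Params p (k + 1) s) V') := by
  obtain ⟨t, Ek, hform, hloc⟩ := (sLaw₁₃CoPH_iff_exists_local θ p k).1 hS
  refine ⟨t, Ek, hform, hloc, fun s hΩ hpre hZ hq hqloc hζm hqm hcoer hΦ => ?_⟩
  refine clause_succ_CoPH_of_Omega_empty_of_pinChi_of_provisos_of_clause_of_graph θ p h hk hM s hΩ hqloc hpre (t s.init) (Ek s.init)
    (fun S a a' Uf ha => action23_sect2ActionDataOfRecord_congr_fluct_of_isFluctLocal p.K _ _ s.init (hloc s.init) (Ek s.init) S a a' ha Uf)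
    (hform.2 s.init).2 hZ hq fun S hSm => ?_
  -- the NEW integrand in closed form: the step's front factor × the old branch at the parent's operand (B3 `newIntegrand_eq_of_pinChi`)
  have heq : (fun U₀ : GaugeField (F.P p.K) k (SU N) => noExpIntegrandAt F N (FluctV N) p.K k (WtOfRecord₁₃H F N θ p s)
        (tkBranchOfRecord F N (FluctV N) θ.ν θ.τ9.M _ p.K (WtOfRecord₁₃H F N θ p s) s.init S k
          (fun ω => sect2Operand F N (FluctV N) p.K (settingOfRecord₁₃ F N θ.toStage13Params p) (θ.rzAt p s) s (t s.init) (Ek s.init)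
            (UbgOfRecord₁₃CoP F N θ.toStage13Params p (k + 1) s) (S, fun j => (ω j).2) (fun j => (ω j).1)))
        ((avOfRecord F N p.K k).avg U₀) U₀) =
      fun U₀ => (chiSeqOfRecord F N θ.ν θ.τ9.M (gOfRecord₁₃ F N θ.toStage13Params p) p.K k s.init U₀ *
          wOfRecord₉ F N θ.toStage9Params p (gOfRecord₁₃ F N θ.toStage13Params p) k s U₀ ((avOfRecord F N p.K k).avg U₀)) *
        tkBranchOfRecord F N (FluctV N) θ.ν θ.τ9.M _ p.K (WtOfRecord₁₃H F N θ p s) s.init S k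
          (fun ω => sect2Operand F N (FluctV N) p.K (settingOfRecord₁₃ F N θ.toStage13Params p) (θ.rzAt p s.init) s.init (t s.init) (Ek s.init)
            (UbgOfRecord₁₃CoP F N θ.toStage13Params p k s.init) (S, fun j => (ω j).2) (fun j => (ω j).1))
          (baseCfg (V := FluctV N) k U₀) :=
    funext fun U₀ => newIntegrand_eq_of_pinChi θ p hM s hΩ (h.zhLocal p (k + 1) s.Ω s.Λ) hqloc (t s.init) (Ek s.init) S
      (fun a a' Uf ha => action23_sect2ActionDataOfRecord_congr_fluct_of_isFluctLocal p.K _ _ s.init (hloc s.init) (Ek s.init) S a a' ha Uf) hZ hq _ U₀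
  rw [heq]
  -- the front factor is measurable and bounded by `1`
  have hχm : Measurable (chiSeqOfRecord F N θ.ν θ.τ9.M (gOfRecord₁₃ F N θ.toStage13Params p) p.K k s.init) :=
    measurable_chiSeqOfRecord_init θ p h hk s
  have hwm : Measurable fun U₀ : GaugeField (F.P p.K) k (SU N) =>
      wOfRecord₉ F N θ.toStage9Params p (gOfRecord₁₃ F N θ.toStage13Params p) k s U₀ ((avOfRecord F N p.K k).avg U₀) := by
    have hg : Measurable fun U₀ : GaugeField (F.P p.K) k (SU N) => ((avOfRecord F N p.K k).avg U₀, U₀) :=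
      (avOfRecord_measurable F N p.K k).prodMk measurable_id
    simpa only [Function.comp_def] using ((h.tstep p k hk).measW s).comp hg
  have hfb : ∀ U₀ : GaugeField (F.P p.K) k (SU N), |chiSeqOfRecord F N θ.ν θ.τ9.M (gOfRecord₁₃ F N θ.toStage13Params p) p.K k s.init U₀ *
      wOfRecord₉ F N θ.toStage9Params p (gOfRecord₁₃ F N θ.toStage13Params p) k s U₀ ((avOfRecord F N p.K k).avg U₀)| ≤ 1 := fun U₀ => by
    rw [abs_mul]
    calc _ ≤ (1 : ℝ) * 1 := mul_le_mul (abs_chiSeqOfRecord_le_one F N θ.ν θ.τ9.M _ p.K k s.init U₀) ((h.tstep p k hk).absW_le s U₀ _)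
          (abs_nonneg _) zero_le_one
      _ = 1 := one_mul 1
  obtain ⟨hΦm, CΦ, hΦle⟩ := hΦ S hSm
  -- v1.1 (T0′ of the FLAG №1 R2b cure): through the two-scale edition (p703718) and the funnel `LocalLaws.localLaws₂`, so the text survives the in-place
  -- re-typing of the proviso row `zhLocal` to print's two-scale law
  exact integrable_front_mul_oldBranch_of_coercive_on_joint_support₂ θ p h.zhLaws hU s (h.zhLocal p (k + 1) s.Ω s.Λ).localLaws₂ S hζm hqm _ (hχm.mul hwm) 1 hfb
    (fun j hj => by
      obtain ⟨c, hc, hrow⟩ := hcoer j hj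
      exact ⟨c, hc, fun ω' hf hsupp => hrow ω' (left_ne_zero_of_mul hf) hsupp⟩)
    (Φ := sect2Operand F N (FluctV N) p.K (settingOfRecord₁₃ F N θ.toStage13Params p) (θ.rzAt p s.init) s.init (t s.init) (Ek s.init)
                (UbgOfRecord₁₃CoP F N θ.toStage13Params p k s.init)) hΦm (fun a U => (sect2Operand_pos p.K _ _ s.init (t s.init) (Ek s.init) _ a U).le) CΦ hΦle

/-- **★★★ THE ALL-PRIMITIVE EDITION, COERCIVITY ON THE JOINT SUPPORT**: the previous theorem with the per-branch operand rows replaced by def-T's six term rows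
(measurability ∕ uniform bounds of the witness's term values at the parent history, read at the embedded background; def-R's background-map row is the theorem
`measurable_UbgOfRecord₁₃CoP`).  After it the hypotheses of the no-expansion 𝐓-step at a generic `θ` are: run∕numerics; per no-expansion history the K0b VALUE
rows (P), (V), `quad_k(∅) = 0`, `k`-locality, measurability, JOINT-SUPPORT COERCIVITY; def-T's six term rows — nothing else. [cite: Balaban1988Convergent, Theorem p.245, Thm 1 p.262, (2.12) p.256, (2.18) p.257, (2.23)–(2.27) pp.258–259, (2.31) p.260, (2.41) p.261, (3.24)–(3.25) p.270; Balaban1987RG1, (2.11) p.267 (shape of the row)] -/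
theorem exists_local_witness_clause_succ_of_sLaw₁₃CoPH_of_coercive_on_joint_support_of_termRows (h : θ.Provisos₁₃CoPH F N) (hU : θ.ZhUnity F N) {k : ℕ} (hk : k < p.K)
    (hM : 1 ≤ θ.τ9.M) (hS : SLaw₁₃CoPH F N θ p k) :
    ∃ (t : SeqOfRecord F θ.ν θ.τ9.M (gOfRecord₁₃ F N θ.toStage13Params p) p.K k → Sect2.TermValues (F.P p.K) (MatA N) (FluctV N) θ.τ9.M)
      (Ek : SeqOfRecord F θ.ν θ.τ9.M (gOfRecord₁₃ F N θ.toStage13Params p) p.K k → ℝ),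
      HasSect2FormAtZS F N (FluctV N) p.K (settingOfRecord₁₃ F N θ.toStage13Params p) k (θ.rzAt p) (WtOfRecord₁₃H F N θ p)
          (UbgOfRecord₁₃CoP F N θ.toStage13Params p k)
          (fun s₀ t₀ => Sect2.LawsRT (sect2TowerOfRecord F N (FluctV N) p.K (settingOfRecord₁₃ F N θ.toStage13Params p) (θ.rzAt p s₀) s₀ t₀)
            (settingOfRecord₁₃ F N θ.toStage13Params p).lf k)
          (slotsOfRecord F N θ.ν θ.τ9 (EOfRecord₁₃ F N θ.toStage13Params) (wOfRecord₉ F N θ.toStage9Params) θ.ppSel p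
            (gOfRecord₁₃ F N θ.toStage13Params p) k) t Ek ∧
      (∀ s₀, IsFluctLocal k (t s₀)) ∧
      ∀ (s : SeqOfRecord F θ.ν θ.τ9.M (gOfRecord₁₃ F N θ.toStage13Params p) p.K (k + 1)), s.Ω (k + 1) = ∅ →
        -- (P) prefix agreement below `k`
        (∀ j, j < k → (θ.zhAt p s).ζ0 j = (θ.zhAt p s.init).ζ0 j ∧ (θ.zhAt p s).quad j = (θ.zhAt p s.init).quad j) →
        -- (V) the generation-`k` pin with the old front factor
        (∀ (V' : GaugeField (F.P p.K) (k + 1) (SU N)) (U₀ : GaugeField (F.P p.K) k (SU N)),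
          (θ.zhAt p s).ζ0 k Set.univ (pairCfgAt (V := FluctV N) k V' U₀) =
            chiSeqOfRecord F N θ.ν θ.τ9.M (gOfRecord₁₃ F N θ.toStage13Params p) p.K k s.init U₀ *
              wOfRecord₉ F N θ.toStage9Params p (gOfRecord₁₃ F N θ.toStage13Params p) k s U₀ ((avOfRecord F N p.K k).avg U₀)) →
        -- `quad_k(∅) = 0` on the two-scale configurations
        (∀ (V' : GaugeField (F.P p.K) (k + 1) (SU N)) (U₀ : GaugeField (F.P p.K) k (SU N)), (θ.zhAt p s).quad k ∅ (pairCfgAt (V := FluctV N) k V' U₀) = 0) →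
        -- `k`-locality of `quad_j(Λ_{j+1})`, `j < k`
        (∀ j, j < k → ∀ ω ω' : MultiCfg (F.P p.K) (SU N) (FluctV N), (∀ i, i ≤ k → ω i = ω' i) →
          (θ.zhAt p s).quad j (s.init.Λ (j + 1)) ω = (θ.zhAt p s).quad j (s.init.Λ (j + 1)) ω') →
        -- measurability of the residual serving `s′`
        (∀ j (Y : Set (Site (F.P p.K) 0)), Measurable ((θ.zhAt p s).ζ0 j Y)) →
        (∀ j (Λ' : Set (Site (F.P p.K) 0)), Measurable ((θ.zhAt p s).quad j Λ')) →
        -- COERCIVITY of `quad_j(Λ_{j+1})` ON THE JOINT SUPPORT: the step's own certificate `χ_k(init s′)(U₀) ≠ 0` AND, for every `i ∈ [j,k)`, an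
        -- `A_i`-fibre-mate with `ζ0_i((Ω_{i+1})ᶜ) ≠ 0` ([I]'s positivity of `𝒬_j` exactly where every certificate of the integrand is alive)
        (∀ j : ℕ, j < k → ∃ c : ℝ, 0 < c ∧ ∀ ω' : MultiCfg (F.P p.K) (SU N) (FluctV N),
          chiSeqOfRecord F N θ.ν θ.τ9.M (gOfRecord₁₃ F N θ.toStage13Params p) p.K k s.init (ω' k).1 ≠ 0 →
          (∀ i, j ≤ i → i < k → ∃ cf : JCfg (F.P p.K) i (SU N) (FluctV N), cf.1 = (ω' i).1 ∧
            (∀ b, b ∉ bondsIn i ((s.init.Λ (i + 1))ᶜ ∩ s.init.Ω (i + 1)) → cf.2 b = (ω' i).2 b) ∧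
            (θ.zhAt p s).ζ0 i (s.init.Ω (i + 1))ᶜ (Function.update ω' i cf) ≠ 0) →
          c * ∑ b ∈ (Set.toFinite (bondsIn j ((s.init.Λ (j + 1))ᶜ ∩ s.init.Ω (j + 1)))).toFinset, ‖(ω' j).2 b‖ ^ 2 ≤
            (θ.zhAt p s).quad j (s.init.Λ (j + 1)) ω') →
        -- def-T: the term values of the witness at the parent history, READ AT THE EMBEDDED BACKGROUND, are measurable …
        (∀ (j : ℕ) (X : (Sect2.domSys (F.P p.K) θ.τ9.M j).Dom) (z : Site (F.P p.K) j) (g' : ℝ),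
          Measurable (fun U : GaugeField (F.P p.K) 0 (SU N) => ((t s.init).E j X z g' (Sect2.ofBackgroundC (settingOfRecord₁₃ F N θ.toStage13Params p).ι U)).re)) →
        (∀ (j : ℕ) (X : (Sect2.domSys (F.P p.K) θ.τ9.M j).Dom),
          Measurable (fun U : GaugeField (F.P p.K) 0 (SU N) => ((t s.init).R j X (Sect2.ofBackgroundC (settingOfRecord₁₃ F N θ.toStage13Params p).ι U)).re)) →
        (∀ (S' : ℕ → Set (Site (F.P p.K) 0)) (j : ℕ) (X : (Sect2.domSys (F.P p.K) θ.τ9.M j).Dom),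
          Measurable (fun q : GaugeField (F.P p.K) 0 (SU N) × MSFluct (F.P p.K) (FluctV N) =>
            ((t s.init).B j X (Sect2.ofBackgroundC (settingOfRecord₁₃ F N θ.toStage13Params p).ι q.1) (S', q.2)).re)) →
        -- … and uniformly bounded
        (∃ CE : ℝ, ∀ (j : ℕ) (X : (Sect2.domSys (F.P p.K) θ.τ9.M j).Dom) (z : Site (F.P p.K) j) (g' : ℝ) (U : GaugeField (F.P p.K) 0 (SU N)),
          |((t s.init).E j X z g' (Sect2.ofBackgroundC (settingOfRecord₁₃ F N θ.toStage13Params p).ι U)).re| ≤ CE) →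
        (∃ CR : ℝ, ∀ (j : ℕ) (X : (Sect2.domSys (F.P p.K) θ.τ9.M j).Dom) (U : GaugeField (F.P p.K) 0 (SU N)),
          |((t s.init).R j X (Sect2.ofBackgroundC (settingOfRecord₁₃ F N θ.toStage13Params p).ι U)).re| ≤ CR) →
        (∃ CB : ℝ, ∀ (j : ℕ) (X : (Sect2.domSys (F.P p.K) θ.τ9.M j).Dom) (U : GaugeField (F.P p.K) 0 (SU N)) (a : Tk.SFluct (F.P p.K) (FluctV N)),
          |((t s.init).B j X (Sect2.ofBackgroundC (settingOfRecord₁₃ F N θ.toStage13Params p).ι U) a).re| ≤ CB) →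
        (slotsTOfRecord F N θ.ν θ.τ9 (EOfRecord₁₃ F N θ.toStage13Params) (wOfRecord₉ F N θ.toStage9Params) θ.ppSel p
            (gOfRecord₁₃ F N θ.toStage13Params p) (k + 1) s = 0 ∨
          ∀ᵐ V' ∂fieldMeasure (F.P p.K) (k + 1) (SU N),
            chiSeqOfRecord F N θ.ν θ.τ9.M (gOfRecord₁₃ F N θ.toStage13Params p) p.K (k + 1) s V' ≠ 0 →
              slotsTOfRecord F N θ.ν θ.τ9 (EOfRecord₁₃ F N θ.toStage13Params) (wOfRecord₉ F N θ.toStage9Params) θ.ppSel p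
                  (gOfRecord₁₃ F N θ.toStage13Params p) (k + 1) s V' =
                sect2Slot F N (FluctV N) p.K (settingOfRecord₁₃ F N θ.toStage13Params p) (θ.rzAt p s) (WtOfRecord₁₃H F N θ p s) s
                  (t s.init) (Ek s.init) (UbgOfRecord₁₃CoP F N θ.toStage13Params p (k + 1) s) V') := by
  obtain ⟨t, Ek, hform, hloc, H⟩ := exists_local_witness_clause_succ_of_sLaw₁₃CoPH_of_coercive_on_joint_support θ p h hU hk hM hS
  refine ⟨t, Ek, hform, hloc, fun s hΩ hpre hZ hq hqloc hζm hqm hcoer hE hR hB hEb hRb hBb => ?_⟩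
  exact H s hΩ hpre hZ hq hqloc hζm hqm hcoer fun S _ =>
    ⟨measurable_sect2Operand_of_termRows p.K _ _ s.init (t s.init) (Ek s.init) (measurable_UbgOfRecord₁₃CoP F N θ.toStage13Params p k s.init) S hE hR (hB S),
      exists_bound_sect2Operand_of_termBounds p.K _ _ s.init (t s.init) (Ek s.init) _ hEb hRb hBb⟩

/-- **★★★ THE PRINT-SHAPED ALL-PRIMITIVE EDITION — def-T's `RegOn Γr` AND COERCIVITY ONLY WHERE EVERY SCALE PRESENT IS REGULAR ON ITS READING REGION**:
for a reading-region selector `Γr` and a regularity constant `cR`, the previous theorem with the joint-support coercivity row replaced by the pair «the residual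
serving `s′` obeys `TkResidualW.RegOn Γr`» (12a″ §3, p.256) and «`quad_j(Λ_{j+1}(init s′))` is coercive on the A-fibre at every configuration whose level-`k`
component passes `χ_k(init s′)` and whose scale-`i` background is `(cR·ε_i)`-regular on `Γr i (Ω_{i+1}(init s′))ᶜ` for EVERY `i ∈ [j,k)`» — the shape in which
[I]'s positivity theorem for small background fields is citable for K0b's VALUE of `Zh.quad`, with NO condition where any certificate of the integrand is dead.
[cite: Balaban1988Convergent, Theorem p.245, (2.10) p.256, (2.2) p.255, (2.17)–(2.18) p.257, Thm 1 p.262, (2.23)–(2.27) pp.258–259, (3.24)–(3.25) p.270; Balaban1987RG1, (2.11) p.267 (shape of the row)] -/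
theorem exists_local_witness_clause_succ_of_sLaw₁₃CoPH_of_regOn_of_coercive_on_joint_reading_of_termRows (h : θ.Provisos₁₃CoPH F N) (hU : θ.ZhUnity F N) {k : ℕ} (hk : k < p.K)
    (hM : 1 ≤ θ.τ9.M) (hS : SLaw₁₃CoPH F N θ p k) (cR : ℝ) (Γr : ℕ → Set (Site (F.P p.K) 0) → Set (Site (F.P p.K) 0)) :
    ∃ (t : SeqOfRecord F θ.ν θ.τ9.M (gOfRecord₁₃ F N θ.toStage13Params p) p.K k → Sect2.TermValues (F.P p.K) (MatA N) (FluctV N) θ.τ9.M)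
      (Ek : SeqOfRecord F θ.ν θ.τ9.M (gOfRecord₁₃ F N θ.toStage13Params p) p.K k → ℝ),
      HasSect2FormAtZS F N (FluctV N) p.K (settingOfRecord₁₃ F N θ.toStage13Params p) k (θ.rzAt p) (WtOfRecord₁₃H F N θ p)
          (UbgOfRecord₁₃CoP F N θ.toStage13Params p k)
          (fun s₀ t₀ => Sect2.LawsRT (sect2TowerOfRecord F N (FluctV N) p.K (settingOfRecord₁₃ F N θ.toStage13Params p) (θ.rzAt p s₀) s₀ t₀)
            (settingOfRecord₁₃ F N θ.toStage13Params p).lf k)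
          (slotsOfRecord F N θ.ν θ.τ9 (EOfRecord₁₃ F N θ.toStage13Params) (wOfRecord₉ F N θ.toStage9Params) θ.ppSel p
            (gOfRecord₁₃ F N θ.toStage13Params p) k) t Ek ∧
      (∀ s₀, IsFluctLocal k (t s₀)) ∧
      ∀ (s : SeqOfRecord F θ.ν θ.τ9.M (gOfRecord₁₃ F N θ.toStage13Params p) p.K (k + 1)), s.Ω (k + 1) = ∅ →
        -- (P) prefix agreement below `k`
        (∀ j, j < k → (θ.zhAt p s).ζ0 j = (θ.zhAt p s.init).ζ0 j ∧ (θ.zhAt p s).quad j = (θ.zhAt p s.init).quad j) →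
        -- (V) the generation-`k` pin with the old front factor
        (∀ (V' : GaugeField (F.P p.K) (k + 1) (SU N)) (U₀ : GaugeField (F.P p.K) k (SU N)),
          (θ.zhAt p s).ζ0 k Set.univ (pairCfgAt (V := FluctV N) k V' U₀) =
            chiSeqOfRecord F N θ.ν θ.τ9.M (gOfRecord₁₃ F N θ.toStage13Params p) p.K k s.init U₀ *
              wOfRecord₉ F N θ.toStage9Params p (gOfRecord₁₃ F N θ.toStage13Params p) k s U₀ ((avOfRecord F N p.K k).avg U₀)) →
        -- `quad_k(∅) = 0` on the two-scale configurations
        (∀ (V' : GaugeField (F.P p.K) (k + 1) (SU N)) (U₀ : GaugeField (F.P p.K) k (SU N)), (θ.zhAt p s).quad k ∅ (pairCfgAt (V := FluctV N) k V' U₀) = 0) →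
        -- `k`-locality of `quad_j(Λ_{j+1})`, `j < k`
        (∀ j, j < k → ∀ ω ω' : MultiCfg (F.P p.K) (SU N) (FluctV N), (∀ i, i ≤ k → ω i = ω' i) →
          (θ.zhAt p s).quad j (s.init.Λ (j + 1)) ω = (θ.zhAt p s).quad j (s.init.Λ (j + 1)) ω') →
        -- measurability of the residual serving `s′`
        (∀ j (Y : Set (Site (F.P p.K) 0)), Measurable ((θ.zhAt p s).ζ0 j Y)) →
        (∀ j (Λ' : Set (Site (F.P p.K) 0)), Measurable ((θ.zhAt p s).quad j Λ')) →
        -- def-T's READING-REGION LAW for the residual serving `s′`, and COERCIVITY of `quad_j(Λ_{j+1})` ONLY WHERE the step's certificate is alive AND the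
        -- scale-`i` background is `(cR·ε_i)`-regular on the reading region `Γr i (Ω_{i+1})ᶜ` for EVERY `i ∈ [j,k)` («V regular on Γ_i for every scale present»)
        (θ.zhAt p s).RegOn F N (FluctV N) θ.ν cR p (gOfRecord₁₃ F N θ.toStage13Params p) Γr →
        (∀ j : ℕ, j < k → ∃ c : ℝ, 0 < c ∧ ∀ ω' : MultiCfg (F.P p.K) (SU N) (FluctV N),
          chiSeqOfRecord F N θ.ν θ.τ9.M (gOfRecord₁₃ F N θ.toStage13Params p) p.K k s.init (ω' k).1 ≠ 0 →
          (∀ i, j ≤ i → i < k →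
            PlaqSmallOn (plaqsOf (pts i (Γr i (s.init.Ω (i + 1))ᶜ))) (cR * epsOfRecord θ.ν (gOfRecord₁₃ F N θ.toStage13Params p) i) (ω' i).1) →
          c * ∑ b ∈ (Set.toFinite (bondsIn j ((s.init.Λ (j + 1))ᶜ ∩ s.init.Ω (j + 1)))).toFinset, ‖(ω' j).2 b‖ ^ 2 ≤
            (θ.zhAt p s).quad j (s.init.Λ (j + 1)) ω') →
        -- def-T: the term values of the witness at the parent history, READ AT THE EMBEDDED BACKGROUND, are measurable …
        (∀ (j : ℕ) (X : (Sect2.domSys (F.P p.K) θ.τ9.M j).Dom) (z : Site (F.P p.K) j) (g' : ℝ),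
          Measurable (fun U : GaugeField (F.P p.K) 0 (SU N) => ((t s.init).E j X z g' (Sect2.ofBackgroundC (settingOfRecord₁₃ F N θ.toStage13Params p).ι U)).re)) →
        (∀ (j : ℕ) (X : (Sect2.domSys (F.P p.K) θ.τ9.M j).Dom),
          Measurable (fun U : GaugeField (F.P p.K) 0 (SU N) => ((t s.init).R j X (Sect2.ofBackgroundC (settingOfRecord₁₃ F N θ.toStage13Params p).ι U)).re)) →
        (∀ (S' : ℕ → Set (Site (F.P p.K) 0)) (j : ℕ) (X : (Sect2.domSys (F.P p.K) θ.τ9.M j).Dom),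
          Measurable (fun q : GaugeField (F.P p.K) 0 (SU N) × MSFluct (F.P p.K) (FluctV N) =>
            ((t s.init).B j X (Sect2.ofBackgroundC (settingOfRecord₁₃ F N θ.toStage13Params p).ι q.1) (S', q.2)).re)) →
        -- … and uniformly bounded
        (∃ CE : ℝ, ∀ (j : ℕ) (X : (Sect2.domSys (F.P p.K) θ.τ9.M j).Dom) (z : Site (F.P p.K) j) (g' : ℝ) (U : GaugeField (F.P p.K) 0 (SU N)),
          |((t s.init).E j X z g' (Sect2.ofBackgroundC (settingOfRecord₁₃ F N θ.toStage13Params p).ι U)).re| ≤ CE) →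
        (∃ CR : ℝ, ∀ (j : ℕ) (X : (Sect2.domSys (F.P p.K) θ.τ9.M j).Dom) (U : GaugeField (F.P p.K) 0 (SU N)),
          |((t s.init).R j X (Sect2.ofBackgroundC (settingOfRecord₁₃ F N θ.toStage13Params p).ι U)).re| ≤ CR) →
        (∃ CB : ℝ, ∀ (j : ℕ) (X : (Sect2.domSys (F.P p.K) θ.τ9.M j).Dom) (U : GaugeField (F.P p.K) 0 (SU N)) (a : Tk.SFluct (F.P p.K) (FluctV N)),
          |((t s.init).B j X (Sect2.ofBackgroundC (settingOfRecord₁₃ F N θ.toStage13Params p).ι U) a).re| ≤ CB) →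
        (slotsTOfRecord F N θ.ν θ.τ9 (EOfRecord₁₃ F N θ.toStage13Params) (wOfRecord₉ F N θ.toStage9Params) θ.ppSel p
            (gOfRecord₁₃ F N θ.toStage13Params p) (k + 1) s = 0 ∨
          ∀ᵐ V' ∂fieldMeasure (F.P p.K) (k + 1) (SU N),
            chiSeqOfRecord F N θ.ν θ.τ9.M (gOfRecord₁₃ F N θ.toStage13Params p) p.K (k + 1) s V' ≠ 0 →
              slotsTOfRecord F N θ.ν θ.τ9 (EOfRecord₁₃ F N θ.toStage13Params) (wOfRecord₉ F N θ.toStage9Params) θ.ppSel p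
                  (gOfRecord₁₃ F N θ.toStage13Params p) (k + 1) s V' =
                sect2Slot F N (FluctV N) p.K (settingOfRecord₁₃ F N θ.toStage13Params p) (θ.rzAt p s) (WtOfRecord₁₃H F N θ p s) s
                  (t s.init) (Ek s.init) (UbgOfRecord₁₃CoP F N θ.toStage13Params p (k + 1) s) V') := by
  obtain ⟨t, Ek, hform, hloc, H⟩ := exists_local_witness_clause_succ_of_sLaw₁₃CoPH_of_coercive_on_joint_support_of_termRows θ p h hU hk hM hS
  refine ⟨t, Ek, hform, hloc, fun s hΩ hpre hZ hq hqloc hζm hqm hreg hcoer hE hR hB hEb hRb hBb => ?_⟩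
  refine H s hΩ hpre hZ hq hqloc hζm hqm (fun j hj => ?_) hE hR hB hEb hRb hBb
  obtain ⟨c, hc, hrow⟩ := hcoer j hj
  refine ⟨c, hc, fun ω' hχ hsupp => hrow ω' hχ fun i hji hik => ?_⟩
  obtain ⟨cf, hcf1, -, hcfζ⟩ := hsupp i hji hik
  have hR' := hreg i _ _ hcfζ
  rw [Function.update_self, hcf1] at hR'
  exact hR'

end Summit.QuantumFields.YangMills.Theorems.BalabanUVNodesN11NoExpansionStepSpecificationOfCoerciveOnJointSupport

end
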